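import Literature.MathematicalPhysics.QuantumManyBody.EliashbergTcCeiling

/-!
# Certificate schema for the Eliashberg `T_c`: subcriticality on a temperature interval from one positive-definite matrix

Companion to `EliashbergTcCeiling` / `EliashbergTcCutoffMonotone`. The per-band certificates of the
conventional branch (`pub/hubbard-eph`, tool `me_certify.py`) establish `λ_max(K(T)) < 1` for every
`T` of an interval `[a, b]` — hence «no superconducting solution above the reported `T_c`» without any
monotonicity assumption on `T ↦ λ_max(K(T))` (which print has only for `T ≥ ω_max/(2√2π)`,
[cite: KiesslingAltshulerYuzbashyan2025II, Thm. 2]) — from ONE exact positive-definiteness check. This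
file proves the implication the certificate relies on, for the symmetrised linearised kernel
`K = D^{-1/2}(Λ − 2μ 11ᵀ)D^{-1/2}` [cite: AllenDynes1975, Eqs. (9)–(12)] (`rankOneDownshift S₀ s μ` with
`S₀ = Λ/(d d)^{1/2}`, `s = d^{-1/2}`):

if `d ≥ d^lo` entrywise, `Λ^lo ≤ Λ ≤ Λ^lo + Δ` entrywise (`Λ`, `Λ^lo` symmetric), every row sum of `Δ` is
`≤ θ`, and `P = diag(d^lo) − Λ^lo + 2μ 11ᵀ − θ I` is positive definite (`xᵀPx > 0` for `x ≠ 0`), then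
`λ_max(K) < 1` (`eigenvalues₀_max_lt_one_of_certificate`).

On a temperature interval the hypotheses hold with `d^lo = d(b)`, `Λ^lo = Λ(b)`, `Δ = Λ(a) − Λ(b)`
because every Matsubara coupling `λ(k; T)` is non-increasing in `T`; `P ≻ 0` is then an exact rational
`LDLᵀ` computation. Ingredients: the interval variation `E = Λ − Λ^lo` satisfies `yᵀEy ≤ θ yᵀy` by the
weighted row-sum bound [cite: HornJohnson2013, Thm. 8.1.26] (`dotProduct_mulVec_le_of_weightedRowSum_le`
with `p ≡ 1`), and `yᵀ(D − Λ + 2μ11ᵀ)y = yᵀ(D − D^lo)y + yᵀPy + yᵀ(θI − E)y > 0` for the rescaled top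
eigenvector `y = D^{-1/2}h`.

## References
* [AllenDynes1975] P. B. Allen, R. C. Dynes, Phys. Rev. B 12 (1975) 905 — Eqs. (9)–(12).
* [HornJohnson2013] R. A. Horn, C. R. Johnson, *Matrix Analysis*, 2nd ed., CUP 2013 — Thm. 8.1.26,
  Thm. 4.2.2.
* [KiesslingAltshulerYuzbashyan2025II] M. K.-H. Kiessling, B. L. Altshuler, E. A. Yuzbashyan, J. Stat.
  Phys. 192 (2025), doi:10.1007/s10955-025-03468-z — Thm. 2 (monotonicity only above `ω_max/(2√2π)`).
-/

noncomputable section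

open scoped Matrix

namespace Literature.MathematicalPhysics.QuantumManyBody

open Finset _root_.Matrix Literature.Analysis.Matrix Real

variable {ι : Type*} [Fintype ι] [DecidableEq ι]

omit [DecidableEq ι] in
/-- `(s sᵀ) x = (s ⬝ x) s`. [folklore] -/
private theorem vecMulVec_self_mulVec' (s x : ι → ℝ) : vecMulVec s s *ᵥ x = (s ⬝ᵥ x) • s := by
  ext i
  simp only [mulVec, dotProduct, vecMulVec_apply, Pi.smul_apply, smul_eq_mul, Finset.sum_mul]
  exact Finset.sum_congr rfl fun j _ => by ring

omit [DecidableEq ι] in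
/-- The quadratic form of the kernel `S₀ − 2μ ssᵀ` splits as `xᵀS₀x − 2μ (s ⬝ x)²`. [folklore] -/
private theorem dotProduct_rankOneDownshift_mulVec (S₀ : Matrix ι ι ℝ) (s : ι → ℝ) (μ : ℝ) (x : ι → ℝ) :
    x ⬝ᵥ rankOneDownshift S₀ s μ *ᵥ x = x ⬝ᵥ S₀ *ᵥ x - 2 * μ * (s ⬝ᵥ x) ^ 2 := by
  rw [rankOneDownshift, sub_mulVec, dotProduct_sub, smul_mulVec, vecMulVec_self_mulVec', dotProduct_smul,
    dotProduct_smul, smul_eq_mul, smul_eq_mul, dotProduct_comm x s]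
  ring

/-- **Certificate schema.** For the symmetrised linearised Eliashberg kernel
`K_{nm} = (Λ_{nm} − 2μ)/(d_n d_m)^{1/2}` (`rankOneDownshift S₀ s μ`, `S₀ = Λ/(d d)^{1/2}`, `s = d^{-1/2}`,
`d > 0`, any real `μ` — the Coulomb term enters `P` and `K` identically): if `d ≥ d^lo`, `Λ^lo ≤ Λ ≤ Λ^lo + Δ` entrywise with `Λ`, `Λ^lo` symmetric, the row sums
of `Δ` are `≤ θ`, and `P = diag(d^lo) − Λ^lo + 2μ11ᵀ − θI` satisfies `xᵀPx > 0` for all `x ≠ 0`, then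
`λ_max(K) < 1`. [cite: HornJohnson2013, Thm. 8.1.26 and Thm. 4.2.2] -/
theorem eigenvalues₀_max_lt_one_of_certificate (Λ Λlo Δ : Matrix ι ι ℝ) (hΛ : Λ.IsHermitian)
    (hΛlo : Λlo.IsHermitian) (d dlo : ι → ℝ) (hd : ∀ n, 0 < d n) (hdlo : ∀ n, dlo n ≤ d n)
    (hlo : ∀ n m, Λlo n m ≤ Λ n m) (hup : ∀ n m, Λ n m ≤ Λlo n m + Δ n m)
    {θ : ℝ} (hθ : ∀ n, ∑ m, Δ n m ≤ θ) {μ : ℝ}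
    (hP : ∀ x : ι → ℝ, x ≠ 0 →
      0 < ∑ n, dlo n * x n ^ 2 - x ⬝ᵥ Λlo *ᵥ x + 2 * μ * (∑ n, x n) ^ 2 - θ * (x ⬝ᵥ x))
    (S₀ : Matrix ι ι ℝ) (hS₀ : S₀.IsHermitian)
    (hS : ∀ n m, S₀ n m = Λ n m / (Real.sqrt (d n) * Real.sqrt (d m)))
    (s : ι → ℝ) (hs : ∀ n, s n = 1 / Real.sqrt (d n)) (hn : 1 ≤ Fintype.card ι) :
    (isHermitian_rankOneDownshift hS₀ s μ).eigenvalues₀ (Fin.castLE hn 0) < 1 := by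
  -- attainment of the top eigenvalue by a unit vector h
  obtain ⟨h, horth, -, hsum⟩ :=
    KyFan.exists_frame_sum_rayleigh_eq (isHermitian_rankOneDownshift hS₀ s μ) (k := 1) hn
  have hunit : h 0 ⬝ᵥ h 0 = 1 := by simpa using horth 0 0
  have hval : h 0 ⬝ᵥ rankOneDownshift S₀ s μ *ᵥ h 0 =
      (isHermitian_rankOneDownshift hS₀ s μ).eigenvalues₀ (Fin.castLE hn 0) := by simpa using hsum
  rw [← hval, dotProduct_rankOneDownshift_mulVec]
  set x := h 0 with hx
  -- rescaled vector y = D^{-1/2} x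
  have hsq : ∀ n, 0 < Real.sqrt (d n) := fun n => Real.sqrt_pos.mpr (hd n)
  set y : ι → ℝ := fun n => x n / Real.sqrt (d n) with hy
  have hxy : ∀ n, x n = Real.sqrt (d n) * y n := fun n => by
    have hne := (hsq n).ne'
    simp only [hy]; field_simp
  -- xᵀ S₀ x = yᵀ Λ y ; s ⬝ x = Σ y ; xᵀ x = Σ d y²
  have e1 : x ⬝ᵥ S₀ *ᵥ x = y ⬝ᵥ Λ *ᵥ y := by
    simp only [dotProduct, mulVec, hS, hxy, Finset.mul_sum]
    refine Finset.sum_congr rfl fun n _ => Finset.sum_congr rfl fun m _ => ?_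
    have h1 := (hsq n).ne'; have h2 := (hsq m).ne'
    field_simp
  have e2 : s ⬝ᵥ x = ∑ n, y n := by
    simp only [dotProduct, hs, hxy]
    exact Finset.sum_congr rfl fun n _ => by have h1 := (hsq n).ne'; field_simp
  have e3 : x ⬝ᵥ x = ∑ n, d n * y n ^ 2 := by
    simp only [dotProduct, hxy]
    refine Finset.sum_congr rfl fun n _ => ?_
    have := Real.mul_self_sqrt (hd n).le
    calc Real.sqrt (d n) * y n * (Real.sqrt (d n) * y n) = (Real.sqrt (d n) * Real.sqrt (d n)) * y n ^ 2 := by ring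
      _ = d n * y n ^ 2 := by rw [this]
  -- y ≠ 0
  have hy0 : y ≠ 0 := by
    intro h0
    have : x ⬝ᵥ x = 0 := by
      rw [e3]; exact Finset.sum_eq_zero fun n _ => by simp [show y n = 0 from congrFun h0 n]
    rw [hunit] at this; exact one_ne_zero this
  -- the interval variation E = Λ − Λlo is symmetric, nonneg, row sums ≤ θ ⇒ yᵀ E y ≤ θ yᵀ y
  have hE : (Λ - Λlo).IsHermitian := hΛ.sub hΛlo
  have hEy : y ⬝ᵥ (Λ - Λlo) *ᵥ y ≤ θ * (y ⬝ᵥ y) := by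
    refine dotProduct_mulVec_le_of_weightedRowSum_le hE (fun n m => by
      simp only [Matrix.sub_apply]; linarith [hlo n m]) (p := fun _ => (1:ℝ)) (fun _ => one_pos)
      (fun n => ?_) y
    simp only [Matrix.sub_apply, mul_one]
    calc ∑ m, (Λ n m - Λlo n m) ≤ ∑ m, Δ n m := Finset.sum_le_sum fun m _ => by linarith [hup n m]
      _ ≤ θ := hθ n
  have esub : y ⬝ᵥ (Λ - Λlo) *ᵥ y = y ⬝ᵥ Λ *ᵥ y - y ⬝ᵥ Λlo *ᵥ y := by
    rw [sub_mulVec, dotProduct_sub]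
  -- positive definiteness of P at y
  have hPy := hP y hy0
  -- Σ dlo y² ≤ Σ d y²
  have hD : ∑ n, dlo n * y n ^ 2 ≤ ∑ n, d n * y n ^ 2 :=
    Finset.sum_le_sum fun n _ => mul_le_mul_of_nonneg_right (hdlo n) (sq_nonneg _)
  have eyy : y ⬝ᵥ y = ∑ n, y n ^ 2 := by simp [dotProduct, pow_two]
  -- assemble: xᵀS₀x − 2μ(s⬝x)² < xᵀx = 1
  rw [e1, e2, ← hunit, e3]
  rw [esub] at hEy
  nlinarith [hEy, hPy, hD, eyy]

end Literature.MathematicalPhysics.QuantumManyBody
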